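import Summits.BirchSwinnertonDyer.Rank1Residual.X11b.LambdaSupplyPrime
import Summits.BirchSwinnertonDyer.Rank1Residual.X11b.Three.LambdaSupplyTwistSupply
import Summits.BirchSwinnertonDyer.Rank1Residual.X11b.Three.UnrSeriesTwistCharacter
import Literature.NumberTheory.GaloisRepresentations.HeckeCharacterFiniteIdeleValuesProofs
import Literature.NumberTheory.GaloisRepresentations.LocalUnitsPrimeToPProofs
import Literature.NumberTheory.Automorphic.AdicCompletionCompact
import HarnessLib

/-!
# Class X11b, every odd prime `p`: the INTERPOLATION-CHARACTER SUPPLY — at every imaginary quadratic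
# `K`, anticyclotomic `ℤ_p`-extension `κ` with topological generator `γ`, and `ι : ℚ̄_p ≃ ℂ`, there is
# an everywhere-unramified Hecke character `φ` of infinity type `(m, −m)`, `m > 0`, whose `p`-adic
# avatar factors through `κ` and takes at `γ` a NON-TORSION principal-unit value (cell `b2b-bsdres`,
# sub-cell `multr1-p2`, gen 25)

HONEST FRAMING (cell `b2b-bsdres`, run/shared/lean/b2b/bsd-rank1-residual/, verbatim in every
file): the goal of the cell is to DELETE the COMBINATION-SHAPED residual classes of the
Birch–Swinnerton-Dyer formula for ALL analytic-rank `≤ 1` elliptic curves over `ℚ` — "full BSD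
formula for every rank `≤ 1` curve in class `C`" assembled STRICTLY from published theorems — so
that the rank-`≤ 1` remainder becomes exactly the CONSTRUCTION-SHAPED classes, which are TYPED
(missing-input `Prop`s), NOT attempted. This is not "finishing BSD". Sub-cell `multr1-p2` is a
RESEARCH ROUTE on class X11b (`ClassX11b W p := r_an = 1 ∧ p ≠ 2 ∧ mult(p) ∧ irr(p)`); no claim
beyond the stated class and loci; X11b's label does not change; NOTHING is booked by this file.

THEOREMS ONLY (class field theory bookkeeping on the tree's Hecke characters; no definition, no
named fact, no `sorry`).

## Why

Three kernel theorems of the cell carry a SUPPLY OF INTERPOLATION CHARACTERS as hypotheses — a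
family `(φ_k, n_k, r_k)` of Hecke characters of `K` UNRAMIFIED EVERYWHERE, of infinity type
`(n_k, −n_k)` with `n_k > 0`, with `p`-adic avatars `r_k` factoring through the anticyclotomic `κ`,
whose values `r_k(γ)` accumulate at `1` without being `1`: multr1-p1's frame rigidity
`R1.isBDPLFunctionInt_unique_of_tendsto` (and with it the `R₀`-descent chain STEP A/B of their GEN
23–24, "modulo (W) and the supply of characters"), x11b3-p3's S27 'V1RIG'
`X11b.constantCoeff_eq_of_isBDPLFunction_of_supply`, and this sub-cell's gen-24 Hsieh-witness rigidity
`isHsiehLFunction_unique_of_tendsto`. This file CONSTRUCTS the basic character at every odd prime from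
the λ-supply at every odd prime (`X11b.lambdaSupplyAt`, gen 25): `φ := λ^M` for the `M` killing the
ramification of `λ` at the primes above `p`, with avatar `e ∘ ψ^M` (`e ∘ ψ = r_λ`); the value
`x₀ = ψ(γ)^M` is a principal unit (x11b3-p3's `norm_avatarValueAt_sub_one_lt`) and is NOT a root of
unity of `p`-power order (else `λ^{M p^k} = 1` by Hecke rigidity, contradicting the infinity type).
The consumer shapes (`φ^{p^k}`, `n_k = M p^k`, values `x₀^{p^k} → 1`) are the sequel file
`X11b/InterpolationCharacterSupplyShapes.lean`.

## What this file proves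

* §1 `HeckeCharacter` generalities: **`exists_pow_forall_isUnramifiedAt`** — every Hecke character
  `χ` of a number field has a power `χ^N`, `N ≥ 1`, UNRAMIFIED AT EVERY finite place (a module of
  definition `(T, e)`, `HeckeCharacter.exists_isModulus`; the local units satisfy
  `u^{(q_v − 1) q_v^{e_v}} ≡ 1 (mod 𝔭_v^{e_v})`, `q_v = #k_v`, so `χ` kills these powers).
* §2 **`not_hasInfinityType_one_of_ne_zero`** — on a totally complex `K` the TRIVIAL Hecke character
  does not have infinity type `(n, −n)` with `n ≠ 0` (evaluate the archimedean factor at the infinite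
  idele all of whose coordinates are `e^{iπ/(2nc)}`, `c` the number of infinite places: it is `−1`);
  `hasInfinityType_one_zero`, `HasInfinityType.pow_nat`.
* §3 **`exists_interpolationCharacter`** (odd `p`, `K` imaginary quadratic, `κ` anticyclotomic,
  `κ.IsTopGenerator γ`, `ι`): ∃ `φ`, `m > 0`, `ψ : Γ_K →ₜ* ℚ̄_pˣ` with `φ` unramified everywhere, of
  type `(m, −m)`, `IsPAdicAvatarOf ι φ (e ∘ ψ)`, `FactorsThroughZp κ (e ∘ ψ)`,
  `‖(e∘ψ)(γ) − 1‖ < 1` and `(e∘ψ)(γ)^{p^k} ≠ 1` for every `k`.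

## References

* [Weil1956] A. Weil, *On a certain type of characters…*, §1–§2.
* [Greenberg1987] R. Greenberg, *Non-vanishing of certain values of `L`-functions*, §2.
* [NeukirchANT1999] J. Neukirch, *Algebraic Number Theory*, Ch. VII §6 (6.11)–(6.12) (modules of
  definition), Ch. II (5.3)–(5.7) (one-units).
* [Castella2018] F. Castella, Math. Ann. 370 (2018), Thm. 3.1 (the interpolation range: `φ` unramified
  of infinity type `(n, −n)`, `n > 0`).
-/

noncomputable section

open scoped NumberField ComplexConjugate
open NumberField IsDedekindDomain Field Filter Topology Polynomial
  Literature.NumberTheory.GaloisRepresentations Literature.NumberTheory.EllipticCurves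
  Literature.NumberTheory.Automorphic NumberField.InfinitePlace NumberField.InfinitePlace.Completion

namespace Summit.BirchSwinnertonDyer.Rank1Residual.X11b.LambdaSupply

/-! ### §1. Every Hecke character has a power unramified everywhere -/

section Unramified

variable {K : Type} [Field K] [NumberField K]

/-- **Local torsion of units modulo a congruence level.** At a finite place `v` of a number field,
with `q = #k_v`, every local unit `u ∈ 𝒪_vˣ` satisfies `|u^{(q-1) q^e} − 1|_v ≤ |ϖ_v|^e`:
`u^{q−1}` is a one-unit (`ū^{q−1} = 1` in `k_v`) and `y ↦ y^{q}` contracts one-units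
(`OneUnits.valued_pow_pow_sub_one_le`). [cite: NeukirchANT1999, Ch. II (5.3)–(5.7)] -/
theorem valued_units_pow_sub_one_le (v : HeightOneSpectrum (𝓞 K)) (e : ℕ) :
    ∃ N : ℕ, 0 < N ∧ ∀ u : (v.adicCompletionIntegers K)ˣ,
      Valued.v ((((u ^ N : (v.adicCompletionIntegers K)ˣ) : v.adicCompletionIntegers K) :
        v.adicCompletion K) - 1) ≤ WithZero.exp (-(e : ℤ)) := by
  classical
  haveI : Finite (IsLocalRing.ResidueField (v.adicCompletionIntegers K)) :=
    Literature.NumberTheory.Automorphic.finite_residueField_adicCompletion K v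
  letI : Fintype (IsLocalRing.ResidueField (v.adicCompletionIntegers K)) := Fintype.ofFinite _
  set q : ℕ := Fintype.card (IsLocalRing.ResidueField (v.adicCompletionIntegers K)) with hq_def
  have hq1 : 1 < q := Fintype.one_lt_card
  have hmax : ∀ z : v.adicCompletionIntegers K,
      z ∈ IsLocalRing.maximalIdeal (v.adicCompletionIntegers K) ↔
        Valued.v (z : v.adicCompletion K) < 1 := fun z => by
    rw [IsLocalRing.mem_maximalIdeal, mem_nonunits_iff]
    exact Valuation.Integer.not_isUnit_iff_valuation_lt_one
  -- `|q| < 1`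
  have hqv : Valued.v ((q : v.adicCompletionIntegers K) : v.adicCompletion K) < 1 := by
    rw [← hmax, ← IsLocalRing.residue_eq_zero_iff, map_natCast, hq_def]
    exact FiniteField.cast_card_eq_zero _
  refine ⟨(q - 1) * q ^ e, Nat.mul_pos (by omega) (pow_pos (by omega) _), fun u => ?_⟩
  -- `u^{q-1}` is a one-unit
  set w : (v.adicCompletionIntegers K)ˣ := u ^ (q - 1) with hw_def
  set y : v.adicCompletion K := ((w : v.adicCompletionIntegers K) : v.adicCompletion K) with hy_def
  have hw1 : Valued.v (y - 1) < 1 := by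
    have hres : IsLocalRing.residue (v.adicCompletionIntegers K)
        ((w : v.adicCompletionIntegers K) - 1) = 0 := by
      rw [map_sub, hw_def, Units.val_pow_eq_pow_val, map_pow, hq_def,
        FiniteField.pow_card_sub_one_eq_one _ ((IsLocalRing.residue_ne_zero_iff_isUnit _).2
          (Units.isUnit u)), map_one, sub_self]
    rw [IsLocalRing.residue_eq_zero_iff, hmax] at hres
    exact_mod_cast hres
  set ρ := max (Valued.v (q : v.adicCompletion K)) (Valued.v (y - 1)) with hρ_def
  have hρ1 : ρ < 1 := max_lt hqv hw1
  have hρe : ρ ≤ WithZero.exp (-1 : ℤ) := by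
    by_cases hρ0 : ρ = 0
    · rw [hρ0]; exact zero_le
    · rw [← WithZero.exp_log hρ0, WithZero.exp_le_exp]
      have : WithZero.log ρ < 0 := by
        rw [← WithZero.exp_lt_exp, WithZero.exp_log hρ0, WithZero.exp_zero]; exact hρ1
      omega
  have hj : Valued.v (y ^ q ^ e - 1) ≤ WithZero.exp (-(e : ℤ)) := by
    refine (OneUnits.valued_pow_pow_sub_one_le K v y hw1.le q e).trans ?_
    calc ρ ^ e * Valued.v (y - 1) ≤ WithZero.exp (-1 : ℤ) ^ e * 1 :=
          mul_le_mul' (pow_le_pow_left₀ zero_le hρe e) hw1.le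
      _ = WithZero.exp (-(e : ℤ)) := by
          rw [mul_one, ← WithZero.exp_nsmul]; simp
  have hpow : (u ^ ((q - 1) * q ^ e) : (v.adicCompletionIntegers K)ˣ) = w ^ q ^ e := by
    rw [pow_mul]
  rw [hpow, Units.val_pow_eq_pow_val, Subring.coe_pow]
  exact hj

/-- **Some power of a Hecke character is unramified at a given place** (a module of definition
`(T, e)`, `HeckeCharacter.exists_isModulus`, kills the local units congruent to `1 mod 𝔭_v^{e_v}`, and
`u^N` is such for the `N` of `valued_units_pow_sub_one_le`). [cite: NeukirchANT1999, Ch. VII §6 (6.11)] -/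
theorem exists_pow_isUnramifiedAt (χ : HeckeCharacter K) (v : HeightOneSpectrum (𝓞 K)) :
    ∃ N : ℕ, 0 < N ∧ (χ ^ N).IsUnramifiedAt v := by
  obtain ⟨T, e, hmod⟩ := χ.exists_isModulus
  obtain ⟨N, hN, hcong⟩ := valued_units_pow_sub_one_le v (e v)
  refine ⟨N, hN, HeckeCharacter.isUnramifiedAt_iff_forall_valued_eq_one.mpr fun w hw => ?_⟩
  -- `w` as a unit of `𝒪_v`
  have hw' : Valued.v ((w⁻¹ : (v.adicCompletion K)ˣ) : v.adicCompletion K) = 1 := by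
    rw [Units.val_inv_eq_inv_val, map_inv₀, hw, inv_one]
  let u : (v.adicCompletionIntegers K)ˣ :=
    ⟨⟨(w : v.adicCompletion K), hw.le⟩, ⟨((w⁻¹ : (v.adicCompletion K)ˣ) : v.adicCompletion K), hw'.le⟩,
      Subtype.ext w.mul_inv, Subtype.ext w.inv_mul⟩
  have hcoe : ((w ^ N : (v.adicCompletion K)ˣ) : v.adicCompletion K) =
      (((u ^ N : (v.adicCompletionIntegers K)ˣ) : v.adicCompletionIntegers K) : v.adicCompletion K) := by
    rw [Units.val_pow_eq_pow_val, Units.val_pow_eq_pow_val, Subring.coe_pow]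
  rw [HeckeCharacter.pow_apply, ← map_pow χ, ← map_pow (localUnits v)]
  refine hmod.map_localUnits_eq_one_of_mem _ ?_ ?_
  · rw [Units.val_pow_eq_pow_val, map_pow, hw, one_pow]
  · rw [hcoe]
    exact hcong u

/-- **Every Hecke character has a power unramified at EVERY finite place** (`N = ∏_{v ramified} N_v`
with the local exponents of `exists_pow_isUnramifiedAt`; the ramified places are finite in number,
`HeckeCharacter.finite_ramifiedPlaces_holds`). [cite: NeukirchANT1999, Ch. VII §6 (6.11)–(6.12)] -/
theorem exists_pow_forall_isUnramifiedAt (χ : HeckeCharacter K) :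
    ∃ N : ℕ, 0 < N ∧ ∀ v : HeightOneSpectrum (𝓞 K), (χ ^ N).IsUnramifiedAt v := by
  classical
  have hfin := HeckeCharacter.finite_ramifiedPlaces_holds χ
  choose N hN hunr using fun v : HeightOneSpectrum (𝓞 K) => exists_pow_isUnramifiedAt χ v
  refine ⟨∏ v ∈ hfin.toFinset, N v, Finset.prod_pos fun v _ => hN v, fun v => ?_⟩
  by_cases hv : χ.IsUnramifiedAt v
  · exact Three.LambdaSupply.isUnramifiedAt_pow' hv _
  · have hvT : v ∈ hfin.toFinset := hfin.mem_toFinset.mpr hv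
    obtain ⟨M, hM⟩ := Finset.dvd_prod_of_mem N hvT
    rw [hM, pow_mul]
    exact Three.LambdaSupply.isUnramifiedAt_pow' (hunr v) M

end Unramified

/-! ### §2. The trivial character has no infinity type `(n, −n)`, `n ≠ 0` -/

section InfinityType

variable {K : Type} [Field K] [NumberField K]

/-- The trivial Hecke character has infinity type `(0, 0)`. [folklore] -/
theorem hasInfinityType_one_zero :
    (1 : HeckeCharacter K).HasInfinityType (fun _ ↦ (0 : ℤ)) (fun _ ↦ (0 : ℤ)) :=
  ⟨Set.univ, Filter.univ_mem, fun x _ => by simp [HeckeCharacter.archFactor_apply]⟩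

/-- Infinity type of a natural power: `χ` of type `(a, b)` ⟹ `χ^n` of type `(n a, n b)`. [folklore] -/
theorem HasInfinityType.pow_nat {χ : HeckeCharacter K} {a b : ℤ}
    (h : χ.HasInfinityType (fun _ ↦ a) (fun _ ↦ b)) (n : ℕ) :
    (χ ^ n).HasInfinityType (fun _ ↦ (n : ℤ) * a) (fun _ ↦ (n : ℤ) * b) := by
  have h' := h.zpow' (n : ℤ)
  rw [zpow_natCast] at h'
  convert h' using 2 <;> simp

/-- **On a totally complex field the trivial Hecke character does not have infinity type `(n, −n)`
with `n ≠ 0`.** Every infinite idele is totally positive (no real place), so the type would give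
`1 = ∏_w ι_w(x_w)^{-n} · conj(ι_w(x_w))^{n}` for EVERY infinite idele `x`
(`HasInfinityType.apply_infiniteIdeles_eq`); at the idele with all coordinates `z = e^{iθ}`,
`θ = π/(2nc)` (`c` the number of infinite places, each `K_w ≅ ℂ` by
`ringEquivComplexOfIsComplex`) the right-hand side is `e^{-2incθ} = e^{-iπ} = −1`. [folklore] -/
theorem not_hasInfinityType_one_of_ne_zero [IsTotallyComplex K] {n : ℤ} (hn : n ≠ 0) :
    ¬ (1 : HeckeCharacter K).HasInfinityType (fun _ ↦ n) (fun _ ↦ -n) := by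
  classical
  intro h
  set c : ℕ := Fintype.card (InfinitePlace K) with hc_def
  have hc : 0 < c := Fintype.card_pos
  -- the angle and the point `z = exp(θ I)`
  set θ : ℂ := (Real.pi : ℂ) / (2 * (n : ℂ) * (c : ℂ)) with hθ_def
  set z : ℂ := Complex.exp (θ * Complex.I) with hz_def
  have hz0 : z ≠ 0 := Complex.exp_ne_zero _
  -- the ring map `ℂ → K ⊗ ℝ = Π_w K_w`
  let ρ : ℂ →+* InfiniteAdeleRing K :=
    RingHom.pi fun w : InfinitePlace K =>
      ((ringEquivComplexOfIsComplex (IsTotallyComplex.isComplex w)).symm : ℂ ≃+* w.Completion).toRingHom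
  let x : (InfiniteAdeleRing K)ˣ := Units.map (ρ : ℂ →* InfiniteAdeleRing K) (Units.mk0 z hz0)
  have hxw : ∀ w : InfinitePlace K, extensionEmbedding w ((x : InfiniteAdeleRing K) w) = z := by
    intro w
    show extensionEmbedding w
      ((ringEquivComplexOfIsComplex (IsTotallyComplex.isComplex w)).symm z) = z
    rw [← ringEquivComplexOfIsComplex_apply (IsTotallyComplex.isComplex w), RingEquiv.apply_symm_apply]
  have hpos : InfiniteIdele.IsTotallyPositive x := fun w hw =>
    absurd hw (not_isReal_iff_isComplex.mpr (IsTotallyComplex.isComplex w))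
  have key := h.apply_infiniteIdeles_eq hpos
  rw [HeckeCharacter.one_apply, Units.val_one, HeckeCharacter.archFactor_apply] at key
  simp_rw [hxw] at key
  rw [Finset.prod_const, Finset.card_univ, ← hc_def] at key
  -- compute the factor: `z^{-n} · conj(z)^{n} = exp(-2 n θ I)`
  have hconjθ : conj θ = θ := by
    rw [hθ_def]
    simp [map_div₀, map_mul, Complex.conj_ofReal, map_ofNat]
  have hconj : conj z = Complex.exp (-(θ * Complex.I)) := by
    rw [hz_def, ← Complex.exp_conj, map_mul, hconjθ, Complex.conj_I, mul_neg]
  have hfac : z ^ (-n) * conj z ^ (- -n) = Complex.exp (-(2 * (n : ℂ) * θ * Complex.I)) := by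
    rw [neg_neg, hconj, hz_def, ← Complex.exp_int_mul, ← Complex.exp_int_mul, ← Complex.exp_add]
    congr 1
    simp only [Int.cast_neg]
    ring
  rw [hfac, ← Complex.exp_nat_mul] at key
  -- `c · (-(2 n θ I)) = -π I`
  have hn' : (n : ℂ) ≠ 0 := Int.cast_ne_zero.mpr hn
  have hc' : (c : ℂ) ≠ 0 := Nat.cast_ne_zero.mpr hc.ne'
  have harg : (c : ℂ) * -(2 * (n : ℂ) * θ * Complex.I) = -(Real.pi : ℂ) * Complex.I := by
    rw [hθ_def]
    field_simp
  rw [harg, neg_mul, Complex.exp_neg, Complex.exp_pi_mul_I] at key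
  norm_num at key

end InfinityType

/-! ### §3. The interpolation character at every odd prime -/

section Supply

open Summit.BirchSwinnertonDyer.Rank1Residual.X11b.Three.LambdaSupply
open Summit.BirchSwinnertonDyer.Rank1Residual.X11b.Halves

variable {K : Type} [Field K] [NumberField K] {p : ℕ} [Fact p.Prime]

omit [NumberField K] in
/-- `(e ∘ ψⁿ)(γ) = ((e ∘ ψ)(γ))ⁿ` in `ℂ_p`. [folklore] -/
theorem avatarValueAt_unitsChar_pow (ψ : absoluteGaloisGroup K →ₜ* (PadicAlgCl p)ˣ)
    (γ : absoluteGaloisGroup K) (n : ℕ) :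
    avatarValueAt ((FramedRep.unitsContinuousMulEquivOfUnique (Fin 1) (PadicAlgCl p) :
      (PadicAlgCl p)ˣ →ₜ* GL (Fin 1) (PadicAlgCl p)).comp (ψ ^ n)) γ =
    avatarValueAt ((FramedRep.unitsContinuousMulEquivOfUnique (Fin 1) (PadicAlgCl p) :
      (PadicAlgCl p)ˣ →ₜ* GL (Fin 1) (PadicAlgCl p)).comp ψ) γ ^ n := by
  rw [avatarValueAt_unitsChar, avatarValueAt_unitsChar, ContinuousMonoidHom.pow_apply,
    Units.val_pow_eq_pow_val, PadicComplex.coe_eq, PadicComplex.coe_eq, map_pow]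

omit [NumberField K] in
/-- Powers of a character through `κ` factor through `κ`. [folklore] -/
theorem factorsThroughZp_unitsChar_pow (κ : ZpExtension K p)
    {ψ : absoluteGaloisGroup K →ₜ* (PadicAlgCl p)ˣ}
    (h : FactorsThroughZp κ ((FramedRep.unitsContinuousMulEquivOfUnique (Fin 1) (PadicAlgCl p) :
      (PadicAlgCl p)ˣ →ₜ* GL (Fin 1) (PadicAlgCl p)).comp ψ)) (n : ℕ) :
    FactorsThroughZp κ ((FramedRep.unitsContinuousMulEquivOfUnique (Fin 1) (PadicAlgCl p) :
      (PadicAlgCl p)ˣ →ₜ* GL (Fin 1) (PadicAlgCl p)).comp (ψ ^ n)) := by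
  rw [factorsThroughZp_unitsChar_iff] at h ⊢
  intro σ hσ
  rw [ContinuousMonoidHom.pow_apply, h σ hσ, one_pow]

/-- **A continuous additive character `χ : ℤ_p → ℂ_p` with `χ(1) = 1` is trivial** (`χ(n) = χ(1)^n`
on the dense `ℕ ⊂ ℤ_p`). [folklore] -/
theorem addChar_eq_one_of_map_one {χ : AddChar ℤ_[p] ℂ_[p]} (hχ : Continuous χ) (h1 : χ 1 = 1)
    (a : ℤ_[p]) : χ a = 1 := by
  have hnat : (fun n : ℕ => χ (n : ℤ_[p])) = fun _ => (1 : ℂ_[p]) :=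
    funext fun n => by rw [addChar_apply_natCast, h1, one_pow]
  have heq := (PadicInt.denseRange_natCast (p := p)).equalizer hχ continuous_const hnat
  exact congrFun heq a

/-- **THE INTERPOLATION CHARACTER (every odd prime `p`).** For `K` imaginary quadratic, `κ : Γ_K ↠ ℤ_p`
ANTICYCLOTOMIC with topological generator `γ` (`κ γ = 1 ∈ ℤ_p`) and `ι : ℚ̄_p ≃ ℂ`, there are a Hecke
character `φ` of `K`, an integer `m > 0` and a continuous character `ψ : Γ_K → ℚ̄_pˣ` such that:
`φ` is UNRAMIFIED AT EVERY finite place; `φ` has infinity type `(m, −m)`; `e ∘ ψ` is the `p`-adic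
avatar of `φ` and FACTORS THROUGH `κ`; the value `x₀ = ψ(γ) ∈ ℂ_p` is a principal unit
(`‖x₀ − 1‖ < 1`) and `x₀^{p^k} ≠ 1` for every `k`. Construction: `φ = λ^M`, `ψ = ψ_λ^M` for the
λ-supply `(λ, e ∘ ψ_λ)` (`X11b.lambdaSupplyAt`) and the exponent `M` of
`exists_pow_forall_isUnramifiedAt`; `‖x₀ − 1‖ < 1` by `norm_avatarValueAt_sub_one_lt` (x11b3-p3);
if `x₀^{p^k} = 1` then the character of `Γ⁻ ≅ ℤ_p` attached to `e ∘ ψ^{p^k}` is trivial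
(`addChar_eq_one_of_map_one`), so `ψ^{p^k} = 1`, so `λ^{M p^k}` and `1` share the avatar `e ∘ 1`
and are EQUAL (x11b3-p2's `eq_of_isPAdicAvatarOf_of_isPAdicAvatarOf`), contradicting
`not_hasInfinityType_one_of_ne_zero`. [cite: Weil1956, §1–§2] [cite: Greenberg1987, §2]
[cite: Castella2018, Thm. 3.1 (arXiv:1704.06608 p. 9)] -/
theorem exists_interpolationCharacter (hp2 : p ≠ 2) (ι : PadicAlgCl p ≃+* ℂ) (K : Type) [Field K]
    [NumberField K] (κ : ZpExtension K p) (hK : IsImaginaryQuadratic K) (hκ : κ.IsAnticyclotomic)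
    (γ : absoluteGaloisGroup K) (hγ : κ.IsTopGenerator γ) :
    ∃ (φ : HeckeCharacter K) (m : ℕ) (ψ : absoluteGaloisGroup K →ₜ* (PadicAlgCl p)ˣ), 0 < m ∧
      (∀ v : HeightOneSpectrum (𝓞 K), φ.IsUnramifiedAt v) ∧
      φ.HasInfinityType (fun _ ↦ (m : ℤ)) (fun _ ↦ -(m : ℤ)) ∧
      IsPAdicAvatarOf ι φ ((FramedRep.unitsContinuousMulEquivOfUnique (Fin 1) (PadicAlgCl p) :
        (PadicAlgCl p)ˣ →ₜ* GL (Fin 1) (PadicAlgCl p)).comp ψ) ∧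
      FactorsThroughZp κ ((FramedRep.unitsContinuousMulEquivOfUnique (Fin 1) (PadicAlgCl p) :
        (PadicAlgCl p)ˣ →ₜ* GL (Fin 1) (PadicAlgCl p)).comp ψ) ∧
      ‖avatarValueAt ((FramedRep.unitsContinuousMulEquivOfUnique (Fin 1) (PadicAlgCl p) :
        (PadicAlgCl p)ˣ →ₜ* GL (Fin 1) (PadicAlgCl p)).comp ψ) γ - 1‖ < 1 ∧
      ∀ k : ℕ, avatarValueAt ((FramedRep.unitsContinuousMulEquivOfUnique (Fin 1) (PadicAlgCl p) :
        (PadicAlgCl p)ˣ →ₜ* GL (Fin 1) (PadicAlgCl p)).comp ψ) γ ^ p ^ k ≠ 1 := by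
  have hp : p.Prime := Fact.out
  haveI : IsTotallyComplex K := hK.2
  obtain ⟨lam, rlam, -, hinf, -, hunr, hav, hfac⟩ := lambdaSupplyAt hp2 ι K κ hK hκ
  -- rank-one currency `rlam = e ∘ ψ₀`
  set ψ₀ : absoluteGaloisGroup K →ₜ* (PadicAlgCl p)ˣ :=
    ((FramedRep.unitsContinuousMulEquivOfUnique (Fin 1) (PadicAlgCl p)).symm :
      GL (Fin 1) (PadicAlgCl p) →ₜ* (PadicAlgCl p)ˣ).comp rlam with hψ₀
  have hr : (FramedRep.unitsContinuousMulEquivOfUnique (Fin 1) (PadicAlgCl p) :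
      (PadicAlgCl p)ˣ →ₜ* GL (Fin 1) (PadicAlgCl p)).comp ψ₀ = rlam := comp_symm_comp_eq rlam
  rw [← hr] at hav hfac
  -- the exponent killing the ramification above `p`
  obtain ⟨M, hM, hunrM⟩ := exists_pow_forall_isUnramifiedAt lam
  have hfac' : ∀ n : ℕ, FactorsThroughZp κ
      ((FramedRep.unitsContinuousMulEquivOfUnique (Fin 1) (PadicAlgCl p) :
        (PadicAlgCl p)ˣ →ₜ* GL (Fin 1) (PadicAlgCl p)).comp (ψ₀ ^ n)) :=
    fun n => factorsThroughZp_unitsChar_pow κ hfac n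
  have hav' : ∀ n : ℕ, IsPAdicAvatarOf ι (lam ^ n)
      ((FramedRep.unitsContinuousMulEquivOfUnique (Fin 1) (PadicAlgCl p) :
        (PadicAlgCl p)ˣ →ₜ* GL (Fin 1) (PadicAlgCl p)).comp (ψ₀ ^ n)) :=
    fun n => isPAdicAvatarOf_pow ι hav hunr n
  have htyp : ∀ n : ℕ, (lam ^ n).HasInfinityType (fun _ ↦ (n : ℤ)) (fun _ ↦ -(n : ℤ)) := fun n => by
    have h := HasInfinityType.pow_nat hinf n
    simpa using h
  refine ⟨lam ^ M, M, ψ₀ ^ M, hM, hunrM, htyp M, hav' M, hfac' M,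
    norm_avatarValueAt_sub_one_lt hγ (hfac' M), fun k hk => ?_⟩
  -- non-torsion: suppose `x₀^{p^k} = 1`
  have hval : avatarValueAt ((FramedRep.unitsContinuousMulEquivOfUnique (Fin 1) (PadicAlgCl p) :
      (PadicAlgCl p)ˣ →ₜ* GL (Fin 1) (PadicAlgCl p)).comp (ψ₀ ^ (M * p ^ k))) γ = 1 := by
    rw [pow_mul, avatarValueAt_unitsChar_pow, hk]
  -- the character of `Γ⁻ ≅ ℤ_p` attached to `e ∘ ψ₀^{M p^k}` is trivial
  obtain ⟨χ, hχc, hχ⟩ := exists_addChar_of_factorsThroughZp (hfac' (M * p ^ k))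
  have hχ1 : χ 1 = 1 := by
    have h := hχ γ
    rw [show κ γ = Multiplicative.ofAdd 1 from hγ, toAdd_ofAdd] at h
    rw [h, hval]
  have hψ1 : ψ₀ ^ (M * p ^ k) = 1 := by
    ext σ
    have h1 := hχ σ
    rw [addChar_eq_one_of_map_one hχc hχ1, avatarValueAt_unitsChar, PadicComplex.coe_eq,
      ← map_one (algebraMap (PadicAlgCl p) ℂ_[p])] at h1
    have h2 := (algebraMap (PadicAlgCl p) ℂ_[p]).injective h1
    rw [← h2]
    simp
  -- so `λ^{M p^k}` and `1` share the avatar `e ∘ 1`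
  have hav1 : IsPAdicAvatarOf ι (lam ^ (M * p ^ k))
      ((FramedRep.unitsContinuousMulEquivOfUnique (Fin 1) (PadicAlgCl p) :
        (PadicAlgCl p)ˣ →ₜ* GL (Fin 1) (PadicAlgCl p)).comp 1) := by
    rw [← hψ1]; exact hav' _
  have heq : lam ^ (M * p ^ k) = 1 :=
    eq_of_isPAdicAvatarOf_of_isPAdicAvatarOf ι hav1 (isPAdicAvatarOf_one ι)
      (fun v hv => isUnramifiedAt_pow' (hunr v hv) _) (fun v _ => isUnramifiedAt_one' v)
  have htyp1 := htyp (M * p ^ k)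
  rw [heq] at htyp1
  have hne : ((M * p ^ k : ℕ) : ℤ) ≠ 0 := by exact_mod_cast (Nat.mul_pos hM (pow_pos hp.pos k)).ne'
  exact not_hasInfinityType_one_of_ne_zero hne htyp1

end Supply

end Summit.BirchSwinnertonDyer.Rank1Residual.X11b.LambdaSupply

end
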